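import Literature.NumberTheory.GaloisRepresentations.ContinuousH1Sah
import HarnessLib

/-!
# Sah's lemma: the "no fixed vector" form of the hypothesis

Glue for the `μ`-transfer core of BSD crux 19276 (HOME/koly/MU-TRANSFER-PROOF.md (F8): restriction
to `G_{L₀}` is injective "by Sah, with a non-trivial central homothety"): the bijectivity hypothesis
`hbij` of the tree's `galoisCohomology.res_one_injective_of_mem_center` holds as soon as `M` is
finite and `z` has no non-zero fixed vector on `M` (`bijective_quotientInvariants_sub_self`), e.g.
when `z` acts on the `p`-torsion group `M` by a scalar `a ≢ 1 (mod p)`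
(`eq_zero_of_smul_eq_of_prime`); whence `res_one_injective_of_forall_fixed_eq_zero`.
-/

noncomputable section

open Function Field

universe u

namespace Literature.NumberTheory.GaloisRepresentations

variable {K : Type u} [Field K] {M : Type u} [AddCommGroup M] [TopologicalSpace M]
  [DiscreteTopology M] (ρ : DiscreteGaloisModule K M)

/-- **`z − 1` is bijective on `M^S` when `M` is finite and `z` has no non-zero fixed vector** (the
hypothesis `hbij` of `galoisCohomology.res_one_injective_of_mem_center`): injective by the
fixed-vector hypothesis, hence bijective on the finite group `M^S`.
[cite: Sah1968, Prop. 2.7 (b)] [cite: NeukirchSchmidtWingberg2008, (1.6.7)] -/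
theorem bijective_quotientInvariants_sub_self [Finite M] (S : Subgroup (absoluteGaloisGroup K))
    [S.Normal] {z : absoluteGaloisGroup K} (hz : ∀ m : M, ρ z m = m → m = 0) :
    Bijective fun x : Representation.invariants (ρ.toRepresentation.comp S.subtype) =>
      ρ.quotientInvariants S (z : absoluteGaloisGroup K ⧸ S) x - x := by
  set g : Representation.invariants (ρ.toRepresentation.comp S.subtype) →+
      Representation.invariants (ρ.toRepresentation.comp S.subtype) :=
    (ρ.quotientInvariants S (z : absoluteGaloisGroup K ⧸ S)).toAddMonoidHom -
      AddMonoidHom.id _ with hg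
  have hfg : (fun x : Representation.invariants (ρ.toRepresentation.comp S.subtype) =>
      ρ.quotientInvariants S (z : absoluteGaloisGroup K ⧸ S) x - x) = ⇑g :=
    funext fun x => by rw [hg, AddMonoidHom.sub_apply, AddMonoidHom.id_apply]; rfl
  have hinj : Injective g := by
    refine (injective_iff_map_eq_zero g).mpr fun x hx => ?_
    have hx' : (ρ z (x : M)) - (x : M) = 0 := by
      rw [← DiscreteGaloisModule.quotientInvariants_apply_coe ρ S z x]
      exact congrArg Subtype.val hx
    exact Subtype.ext (hz _ (sub_eq_zero.mp hx'))
  rw [hfg]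
  exact ⟨hinj, Finite.surjective_of_injective hinj⟩

/-- **Restriction `H¹(K, M) → H¹(E, M)` is injective when some `z ∈ Γ_K` with central image in
`Gal(E/K)` has no non-zero fixed vector on the finite module `M`** (Sah + inflation–restriction, tree
`res_one_injective_of_mem_center`). [cite: Sah1968, Prop. 2.7 (b)] [cite: NeukirchSchmidtWingberg2008, (1.6.7)] -/
theorem galoisCohomology.res_one_injective_of_forall_fixed_eq_zero [Finite M]
    (E : IntermediateField K (AlgebraicClosure K)) [Normal K E] {z : absoluteGaloisGroup K}
    (hzc : (z : absoluteGaloisGroup K ⧸ absGaloisFixingSubgroup E) ∈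
      Subgroup.center (absoluteGaloisGroup K ⧸ absGaloisFixingSubgroup E))
    (hz : ∀ m : M, ρ z m = m → m = 0) :
    Injective (galoisCohomology.res ρ E 1) :=
  galoisCohomology.res_one_injective_of_mem_center ρ E hzc
    (bijective_quotientInvariants_sub_self ρ (absGaloisFixingSubgroup E) hz)

omit [TopologicalSpace M] [DiscreteTopology M] in
/-- **A homothety `a ≢ 1 (mod p)` of a `p`-torsion group has no non-zero fixed vector**: if
`p·m = 0` and `a·m = m` with `p ∤ (a − 1)`, then `m = 0` (the order of `m` divides `p` and `a − 1`).
Used with the tree's `exists_galoisRepTorsion_eq_smul_of_not_surjective` ("a non-trivial central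
homothety in the image"). [cite: Sah1968, Prop. 2.7 (b)] -/
theorem eq_zero_of_smul_eq_of_prime {p : ℕ} (hp : p.Prime) {m : M} (hpm : p • m = 0) {a : ℤ}
    (ha : ¬ (p : ℤ) ∣ a - 1) (ham : a • m = m) : m = 0 := by
  have h1 : (a - 1) • m = 0 := by rw [sub_smul, one_smul, ham, sub_self]
  have hord : addOrderOf m ∣ p := addOrderOf_dvd_of_nsmul_eq_zero hpm
  rcases (Nat.dvd_prime hp).mp hord with h | h
  · exact AddMonoid.addOrderOf_eq_one_iff.mp h
  · exfalso
    apply ha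
    have h2 : (addOrderOf m : ℤ) ∣ a - 1 := addOrderOf_dvd_iff_zsmul_eq_zero.mpr h1
    rwa [h] at h2

end Literature.NumberTheory.GaloisRepresentations

end
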